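import Literature.AlgebraicTopology.CharacteristicClasses.CompletionThomClassIndexUnit
import Literature.AlgebraicTopology.SingularHomology.LocalDegreeLinearization
import Literature.AlgebraicTopology.SingularHomology.PositiveAtlasOrientation
import Literature.Topology.FourManifolds.IntersectionLatticeOrientationProofs
import Mathlib.Analysis.Convex.Contractible
import HarnessLib

/-!
# The local index of a non-degenerate zero of a section of a complex vector bundle is the sign of its
# Jacobian (times a universal unit) — every rank

D. McDuff, D. Salamon, *Introduction to Symplectic Topology*, 3rd ed. (2017), Thm. 2.7.5 (rank one)
and Ex. 4.4.3 (v): the zeros of a section transverse to the zero section contribute `±1` to the top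
Chern number, the sign telling whether the linearisation `Ds(p) : T_pB → E_p` preserves or reverses
orientation; G. Bredon, *Topology and Geometry* (1993), VI.7 and J. Milnor, J. Stasheff,
*Characteristic Classes* (1974), Appendix A: the local degree of a `C¹` map with invertible Jacobian
is the sign of the Jacobian (the tree's `HomologicalOrientation.localDegree_of_hasFDerivAt`).

For the tree's local index `ind_p(s) = E.localIndex s hs ℤ …` of `TopChernNumberLocalization` (the
relative Kronecker pairing of the pulled-back relative Thom class of `P(E ⊕ ℂ)` with the local
orientation `μ_p`), this file proves the rank-`k` version of `LineLocalIndexDegree`: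

* `ContractibleSpace` bookkeeping: a chart ball `W = c⁻¹(B(c p, r))` around a point is open,
  contractible (`Convex.contractibleSpace`) and can be taken inside any neighbourhood;
* `localRepK` — the local representative `x ↦ L⁻¹ e_{c⁻¹ x}(s(c⁻¹ x)) : ℝⁿ → ℝⁿ` of `s` in the atlas
  trivialisation `e = e_p` at `p`, a chart `c` of the base and a real frame `L : ℝⁿ ≅ F` of the fibre;
* **`localIndex_eq_sign_det_mul_indexUnitK`** — if `s p = 0`, `p` is an isolated zero, the
  `ℤ`-orientation `μ` of `B` at `p` is the chart transport of an orientation `g` of `ℝⁿ`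
  (`μ_p = (chartTransport c …)⁻¹ g_{c p}`, the defining shape of the orientation attached to an
  oriented atlas), and the local representative has an invertible derivative `A` at `c p`, then

    `ind_p(s) = sign(det A) · κ(L, g)`,   `κ(L, g) = ±1` (`CompletionThomClassIndexUnit`).

  Proof: on a contractible chart ball `W ∋ p` inside `U_p ∩ K` (`K ⊆ U_{e_p}` a closed chart
  neighbourhood), `ind_p(s) = ⟨ω_k^rel,vec, š_* μ_p|_W⟩` (`localIndex_eq_vecSectionK`); the square
  `š ∘ c⁻¹ = L ∘ t` (`t` the local representative) and the naturality of the cross-universe transport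
  (`relativeSingularHomology.xEquiv_map`) turn `š_* μ_p|_W` into `L_* t_* (g_{c p}|_{c(W)})`, and
  `t_* (g_{c p}|) = sign(det A) g_0` by the local degree theorem.

Everything is proved; no named facts.

## References

* [McDuffSalamon2017] D. McDuff, D. Salamon, Introduction to Symplectic Topology, 3rd ed., OUP 2017,
  Thm. 2.7.5 (proof), Ex. 4.4.3 (v).
* [Bredon1993] G. E. Bredon, Topology and Geometry, GTM 139, Springer 1993, VI.7.
* [MilnorStasheff1974] J. Milnor, J. Stasheff, Characteristic Classes, PUP 1974, §9 Thm. 9.1, App. A.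
* [HatcherAT2002] A. Hatcher, Algebraic Topology, CUP 2002, Thm. 2.20, §3.3 pp. 231–236.
-/

noncomputable section

open CategoryTheory Limits Function Set Bundle Topology Metric Literature.AlgebraicTopology.SingularHomology
  Literature.Topology.FourManifolds.HomologicalOrientationOfSmooth
open scoped LinearAlgebra.Projectivization

namespace Literature.AlgebraicTopology.CharacteristicClasses

/-! ### Contractible chart balls -/

section ChartBall

variable {B : Type} [TopologicalSpace B] {n : ℕ} (c : OpenPartialHomeomorph B (EuclideanSpace ℝ (Fin n)))

/-- **The chart ball** `W = c.source ∩ c⁻¹(B(c p, r))`. [folklore] -/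
def chartBall (p : B) (r : ℝ) : Set B := c.source ∩ c ⁻¹' ball (c p) r

/-- The chart ball is open. [folklore] -/
theorem isOpen_chartBall (p : B) (r : ℝ) : IsOpen (chartBall c p r) := c.isOpen_inter_preimage isOpen_ball

/-- The chart ball lies in the chart source. [folklore] -/
theorem chartBall_subset_source (p : B) (r : ℝ) : chartBall c p r ⊆ c.source := inter_subset_left

/-- The centre lies in the chart ball. [folklore] -/
theorem mem_chartBall {p : B} (hp : p ∈ c.source) {r : ℝ} (hr : 0 < r) : p ∈ chartBall c p r := ⟨hp, mem_ball_self hr⟩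

/-- The chart image of the chart ball is the ball, when the ball lies in the target. [folklore] -/
theorem image_chartBall {p : B} {r : ℝ} (hrt : ball (c p) r ⊆ c.target) : c '' chartBall c p r = ball (c p) r := by
  ext y
  constructor
  · rintro ⟨x, hx, rfl⟩
    exact hx.2
  · intro hy
    exact ⟨c.symm y, ⟨c.map_target (hrt hy), by rw [mem_preimage, c.right_inv (hrt hy)]; exact hy⟩, c.right_inv (hrt hy)⟩

/-- **The chart ball is contractible** (it is homeomorphic to a Euclidean ball). [folklore] -/
theorem contractibleSpace_chartBall [T1Space B] {p : B} {r : ℝ} (hr : 0 < r)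
    (hrt : ball (c p) r ⊆ c.target) : ContractibleSpace ↥(chartBall c p r) := by
  haveI : ContractibleSpace ↥(ball (c p) r) := (convex_ball (c p) r).contractibleSpace ⟨c p, mem_ball_self hr⟩
  have h : ↥(chartBall c p r) ≃ₜ ↥(ball (c p) r) :=
    (chartHomeo c (chartBall_subset_source c p r)).trans (Homeomorph.setCongr (image_chartBall c hrt))
  exact h.contractibleSpace

/-- **A chart ball inside any neighbourhood**: for `U ∈ 𝓝 p` there is `r > 0` with
`B(c p, r) ⊆ c.target` and `W = c⁻¹(B(c p, r)) ⊆ U`. [folklore] -/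
theorem exists_chartBall_subset {p : B} (hp : p ∈ c.source) {U : Set B} (hU : U ∈ 𝓝 p) :
    ∃ r : ℝ, 0 < r ∧ ball (c p) r ⊆ c.target ∧ chartBall c p r ⊆ U := by
  -- `c(U ∩ c.source)` is a neighbourhood of `c p` in the target
  have h1 : c.target ∩ c.symm ⁻¹' (U ∩ c.source) ∈ 𝓝 (c p) := by
    apply Filter.inter_mem (c.open_target.mem_nhds (c.map_source hp))
    refine c.continuousAt_symm (c.map_source hp) |>.preimage_mem_nhds ?_
    rw [c.left_inv hp]
    exact Filter.inter_mem hU (c.open_source.mem_nhds hp)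
  obtain ⟨r, hr, hball⟩ := Metric.mem_nhds_iff.1 h1
  refine ⟨r, hr, fun y hy ↦ (hball hy).1, fun x hx ↦ ?_⟩
  have h2 := hball hx.2
  rw [mem_inter_iff, mem_preimage, c.left_inv hx.1] at h2
  exact h2.2.1

end ChartBall

/-! ### The local index of a zero with non-degenerate linearisation -/

namespace ComplexVectorBundle

variable {B : Type} [TopologicalSpace B] (E : ComplexVectorBundle.{0, 0} B)
  (s : ∀ b, E.E b) (hs : Continuous fun b ↦ (⟨b, s b⟩ : TotalSpace E.F E.E))

/-- **The local representative of a section** in the atlas trivialisation `e_p` at `p`, a chart `c` of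
the base and a real frame `L : ℝⁿ ≅ F` of the fibre: `x ↦ L⁻¹ e_{c⁻¹ x}(s(c⁻¹ x)) : ℝⁿ → ℝⁿ` (junk off
`c.target`). [cite: McDuffSalamon2017, Thm. 2.7.5 and Ex. 4.4.3 (v)] -/
def localRepK (p : B) {n : ℕ} (c : OpenPartialHomeomorph B (EuclideanSpace ℝ (Fin n))) (L : EuclideanSpace ℝ (Fin n) ≃L[ℝ] E.F)
    (x : EuclideanSpace ℝ (Fin n)) : EuclideanSpace ℝ (Fin n) :=
  L.symm ((E.triv p) ⟨c.symm x, s (c.symm x)⟩).2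

/-- **The local index of a zero with non-degenerate linearisation is the sign of the Jacobian times
the index unit (every rank).**  Let `p` be an isolated zero of the continuous section `s` of the
complex vector bundle `E` of rank `k ≥ 1` over `B` (charts in `ℝⁿ`, `n = 2k`), `c ∋ p` a chart through
which the `ℤ`-orientation `μ` of `B` at `p` is the transport of an orientation `g` of `ℝⁿ`, `L` a real
frame of the fibre, and suppose the local representative `x ↦ L⁻¹ e_{c⁻¹x}(s(c⁻¹ x))` (`e = e_p`) is
differentiable at `c p` with invertible derivative `A`.  Then

  `ind_p(s) = sign(det A) · κ(L, g)`,  `κ(L, g) = ±1`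

(McDuff–Salamon 2017, Thm. 2.7.5 / Ex. 4.4.3 (v): a transverse zero counts `±1` according to the
orientation behaviour of `Ds(p)`; Milnor–Stasheff App. A / Bredon VI.7: the local degree of a `C¹` map
is the sign of its Jacobian, the tree's `localDegree_of_hasFDerivAt`).
[cite: McDuffSalamon2017, Thm. 2.7.5 and Ex. 4.4.3 (v)] [cite: Bredon1993, VI.7] -/
theorem localIndex_eq_sign_det_mul_indexUnitK [T2Space B] [ParacompactSpace B] (hE : 0 < E.rank) {n : ℕ}
    (hn : 2 * E.rank = n) (μ : HomologicalOrientation ℤ B n) (p : B) (hsp : s p = 0) (hU : IsOpen (indexDomain s p))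
    (g : HomologicalOrientation ℤ (EuclideanSpace ℝ (Fin n)) n) (c : OpenPartialHomeomorph B (EuclideanSpace ℝ (Fin n)))
    (hpc : p ∈ c.source)
    (hμ : μ.localClass p = (chartTransport c c.open_source subset_rfl hpc n).symm (g.localClass (c p)))
    (L : EuclideanSpace ℝ (Fin n) ≃L[ℝ] E.F) {A : EuclideanSpace ℝ (Fin n) →L[ℝ] EuclideanSpace ℝ (Fin n)}
    (ht : HasFDerivAt (E.localRepK s p c L) A (c p))
    (hA : LinearMap.det (A : EuclideanSpace ℝ (Fin n) →ₗ[ℝ] EuclideanSpace ℝ (Fin n)) ≠ 0) :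
    E.localIndex s hs ℤ hE hn μ p =
      (if 0 < LinearMap.det (A : EuclideanSpace ℝ (Fin n) →ₗ[ℝ] EuclideanSpace ℝ (Fin n)) then 1 else -1) *
        indexUnitK E.F rfl hE hn L g := by
  -- a closed chart neighbourhood `K ⊆ U_{e_p}` and a contractible chart ball `W ∋ p` inside `U_p ∩ K°`
  obtain ⟨K, hKn, hKc, hK⟩ := E.exists_closed_chart_nhds p
  have hp : p ∈ (E.triv p).baseSet := FiberBundle.mem_baseSet_trivializationAt' p
  obtain ⟨r, hr, hrt, hWsub⟩ := exists_chartBall_subset c hpc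
    (Filter.inter_mem (interior_mem_nhds.2 hKn) (hU.mem_nhds (mem_indexDomain_self s p)))
  set W : Set B := chartBall c p r with hWdef
  have hWo : IsOpen W := isOpen_chartBall c p r
  have hpW : p ∈ W := mem_chartBall c hpc hr
  have hWK : W ⊆ K := fun b hb ↦ interior_subset (hWsub hb).1
  have hWU : W ⊆ indexDomain s p := fun b hb ↦ (hWsub hb).2
  have hWc : W ⊆ c.source := chartBall_subset_source c p r
  have hWe : W ⊆ (E.triv p).baseSet := hWK.trans hK
  haveI : ContractibleSpace ↥W := contractibleSpace_chartBall c hr hrt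
  have hcW : c '' W = ball (c p) r := image_chartBall c hrt
  have hW' : IsOpen (c '' W) := c.isOpen_image_of_subset_source hWo hWc
  have hcpW : c p ∈ c '' W := mem_image_of_mem c hpW
  have hWt : c '' W ⊆ c.target := fun x hx ↦ by
    obtain ⟨b, hb, rfl⟩ := hx
    exact c.map_source (hWc hb)
  have hsymm : ∀ x ∈ c '' W, c.symm x ∈ W := by
    rintro _ ⟨b, hb, rfl⟩
    rwa [c.left_inv (hWc hb)]
  rw [E.localIndex_eq_vecSectionK p hK hKc hWK s hs hE hn μ hU hWo hpW hWU]
  -- the model map `t = localRepK|_{c(W)} : (c(W), c(W) ∖ c p) → (ℝⁿ, ℝⁿ ∖ 0)`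
  have hcont : ContinuousOn (fun b ↦ ((E.triv p) ⟨b, s b⟩).2) (E.triv p).baseSet :=
    continuousOn_iff_continuous_restrict.2 (E.vecSectionK p s hs (subset_rfl : (E.triv p).baseSet ⊆ (E.triv p).baseSet)).continuous
  have htc : ContinuousOn (E.localRepK s p c L) (c '' W) :=
    L.symm.continuous.comp_continuousOn (hcont.comp (c.continuousOn_symm.mono hWt) fun x hx ↦ hWe (hsymm x hx))
  have ht0 : E.localRepK s p c L (c p) = 0 := by
    unfold localRepK
    rw [c.left_inv hpc, hsp, ← linEquivAt_apply (K := ℂ) (E.triv p) hp, map_zero, map_zero]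
  have hmapsW : MapsTo (fun w : ↥(c '' W) ↦ E.localRepK s p c L w) ({(⟨c p, hcpW⟩ : ↥(c '' W))}ᶜ : Set _)
      ({0}ᶜ : Set (EuclideanSpace ℝ (Fin n))) := by
    intro w hw h0
    change E.localRepK s p c L w = 0 at h0
    have hb : c.symm w ∈ W := hsymm w w.2
    have hbp : (c.symm w : B) ≠ p := by
      intro hbp
      apply hw
      apply Subtype.ext
      change (w : EuclideanSpace ℝ (Fin n)) = c p
      rw [← hbp, c.right_inv (hWt w.2)]
    apply (hWU hb).resolve_left hbp
    unfold localRepK at h0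
    rw [ContinuousLinearEquiv.map_eq_zero_iff, ← linEquivAt_apply (K := ℂ) (E.triv p) (hWe hb),
      ContinuousLinearEquiv.map_eq_zero_iff] at h0
    exact h0
  have hdeg := g.localDegree_of_hasFDerivAt (E.localRepK s p c L) hW' hcpW htc ht hA ht0 hmapsW
  -- the homeomorphism of pairs `φ = c| : (W, W ∖ p) ≅ (c(W), c(W) ∖ c p)` and the square `š ∘ φ⁻¹ = L ∘ t`
  set φ := chartHomeo c hWc with hφ
  have hφp : φ ⟨p, hpW⟩ = ⟨c p, hcpW⟩ := rfl
  have hAB : MapsTo φ.symm ({(⟨c p, hcpW⟩ : ↥(c '' W))}ᶜ : Set _) ({(⟨p, hpW⟩ : ↥W)}ᶜ : Set ↥W) := by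
    intro w hw h
    apply hw
    rw [mem_singleton_iff] at h ⊢
    rw [← φ.apply_symm_apply w, h, hφp]
  have hBA : MapsTo φ.symm.symm ({(⟨p, hpW⟩ : ↥W)}ᶜ : Set ↥W) ({(⟨c p, hcpW⟩ : ↥(c '' W))}ᶜ : Set _) := by
    intro b hb h
    apply hb
    rw [mem_singleton_iff] at h ⊢
    rw [Homeomorph.symm_symm, ← hφp] at h
    exact φ.injective h
  have hsq : ∀ w : ↥(c '' W), (E.vecSectionK p s hs hWe) (φ.symm w) =
      L.toHomeomorph ((⟨fun v : ↥(c '' W) ↦ E.localRepK s p c L v, htc.restrict⟩ : C(↥(c '' W), EuclideanSpace ℝ (Fin n))) w) := by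
    intro w
    change ((E.triv p) ⟨c.symm w, s (c.symm w)⟩).2 = L (L.symm _)
    rw [ContinuousLinearEquiv.apply_symm_apply]
  have key := relativeSingularHomology.xEquiv_map ℤ ℤ φ.symm L.toHomeomorph
    (⟨fun v : ↥(c '' W) ↦ E.localRepK s p c L v, htc.restrict⟩ : C(↥(c '' W), EuclideanSpace ℝ (Fin n)))
    (E.vecSectionK p s hs hWe) hsq hAB hBA (mapsTo_frame E.F L) (mapsTo_frame_symm E.F L) hmapsW
    (E.mapsTo_vecSectionK p s hs hWe hpW hWU) n ((localHomology.openSubsetIso ℤ ℤ hW' hcpW n).inv (g.localClass (c p)))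
  -- the transported class on `(W, W ∖ p)` is the local orientation `μ_p`
  have hT : chartTransport c hWo hWc hpW n = chartTransport c c.open_source subset_rfl hpc n :=
    LinearEquiv.ext fun z ↦ chartTransport_mono c hWo c.open_source hWc subset_rfl hpW n z
  have hμ' : μ.localClass p = (chartTransport c hWo hWc hpW n).symm (g.localClass (c p)) := by
    rw [hT]
    exact hμ
  have h1 : (localHomology.openSubsetIso ℤ ℤ hWo hpW n).inv (μ.localClass p) =
      (localHomology.xEquiv ℤ ℤ φ ⟨p, hpW⟩ n).symm
        ((localHomology.openSubsetIso ℤ ℤ (c.isOpen_image_of_subset_source hWo hWc) (mem_image_of_mem c hpW) n).inv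
          (g.localClass (c p))) := by
    rw [hμ', chartTransport_symm_apply]
    exact Iso.hom_inv_id_apply (localHomology.openSubsetIso ℤ ℤ hWo hpW n) _
  have hclass : relativeSingularHomology.xEquiv ℤ ℤ φ.symm hAB hBA n
      ((localHomology.openSubsetIso ℤ ℤ hW' hcpW n).inv (g.localClass (c p))) =
      (localHomology.openSubsetIso ℤ ℤ hWo hpW n).inv (μ.localClass p) := by
    rw [h1]
    exact (relativeSingularHomology.xEquiv_symm_apply ℤ ℤ φ (mapsTo_compl_singleton φ.toEquiv ⟨p, hpW⟩)
      (mapsTo_symm_compl_singleton φ.toEquiv ⟨p, hpW⟩) hBA n _).symm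
  rw [hclass] at key
  rw [← key, hdeg, indexUnitK, modelGeneratorK]
  split_ifs with hdet
  · rw [one_mul]
    rfl
  · rw [map_neg, map_neg, neg_one_mul]
    rfl

end ComplexVectorBundle

end Literature.AlgebraicTopology.CharacteristicClasses

end
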